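import Summits.QuantumFields.YangMills.Theorems.BalabanUVNodesK0RecordFormatNamesLocB

/-!
# K0⁷ — THE RECORD-SIDE FORMAT NAMES, EDITION 16c = CRIT-1 g34's J1′ ON-SIGHT VERDICT on ed.16 (nodeO STATUS 02:35:27Z) + WORD (a)(b)(c) (02:36:04Z), EXECUTED append-only:
# N-1 (UNITS) — the CHART-UNIT (`ξ`-scaled) localized family `windowRespξ ∕ recordHrLocξ ∕ recordALocξ ∕ recordCfgLocξ ∕ recordPairLocξ ∕ recordJLocξ ∕ recordGkLocWξ ∕ recordEmbLocξ ∕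
# IotaRowAtLocξ ∕ ResponseRowAtLocξ`; N-2 (PACKAGING) — the volume-independent window `recordWindow R0 z₀`, `NoWrapAt R0 z₀`, `recordGkLocAtξ R0 z₀`, `recordResponse9DataFromLocAtξ … R0 z₀`,
# the generic receipt `Response9DLocW` (inner guard AND per-member no-wrap guards INSIDE the rows) and the record's `Response9DLocAt F θ a Mc k K₀ R0 R3 z₀ α₂ C₉ δ₀` (CRIT-1's name)

Cell `ym-nodeO-ideate` ∕ `ym-balaban-port`, DEFINER seat `ym-nodeO-def-1` (gen 34); `--kind definition --supports stmt-QuantumFields-20541 --as helper`; count-neutral.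
[I] = [Balaban1987RG1], [15] = [Balaban1985Variational], [B6] = [Balaban1984PropagatorsII].

N-1 (UNITS), CRIT-1 verbatim in substance: the tree's constraint average `bondAvg` is the MEAN along the coarse bond, so `hOp`(unit datum) = `O(1)` at the source — print's `H_k(□₀)B`
in A-UNITS (`U = exp(iξA)`); the CHART reads `log U = iξA = O(ξ)`: the coarse holonomy of the fine configuration ADDS `L^{k+1}` fine logarithms, so the linear-order localized field that
reproduces its datum (`M·(exp A′_B) = exp(ρ₈B)`) is `A′_B = ξ·H(□₀)(ρ₈B)`, `ξ = eta (k+1) = L^{−(k+1)}` (`L^{k+1}·ξ = 1`).  Hence `windowRespξ := eta (k+1) · windowResp` (ed.16's `windowResp` stays =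
print's `H(□₀)` LITERALLY, A-units — both names kept, units SAID), and the chart-unit chain `recordHrLocξ ∕ recordALocξ ∕ recordCfgLocξ ∕ recordPairLocξ ∕ recordJLocξ ∕ recordGkLocWξ ∕
recordEmbLocξ` re-built over it (ed.16's A-unit chain `recordALoc ∕ recordCfgLoc ∕ recordPairLoc ∕ recordJLoc ∕ recordGkLocW ∕ recordEmbLoc ∕ IotaRowAtLoc ∕ ResponseRowAtLoc` is thereby
DEPRECATED for the chart — wrong units by `L^{k+1}` — and consumed by nothing).
N-2 (PACKAGING): the rows and the token speak of the SAME window — the TERM's, at a VOLUME-INDEPENDENT index (centre `z₀ : Fin 4 → ℤ`, radius `R0 : ℕ`; inner radius `R3`, `R3 + 1 ≤ R0`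
displayed by the cutter EARLY): `recordWindow F k K R0 z₀ := windowSites … R0 (recordCubeCtr … z₀)`; the source-centred ed.16 §24c (`recordBox0 ∕ recordGkLoc ∕ recordResponse9Data[From]Loc ∕
Response9DAtLoc`) is DEPRECATED (unprovable near the travelling wall; disconnected from the fixed-window JOIN receipts), and ed.16b's A-unit `recordGkLocAt ∕ recordResponse9Data[From]LocAt ∕
Response9DAtLocAt` are superseded by the `ξ`-twins here (ed.16b's `cubeNest ∕ innerCube ∕ recordWindowLoc ∕ WindowNoWrap ∕ InInnerCube ∕ nestRadius` remain valid CONVENIENCE instances: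
`recordWindowLoc Mc = recordWindow (nestRadius Mc 5)`, `WindowNoWrap Mc = NoWrapAt (nestRadius Mc 5)` by `rfl`).  WORD (b): the no-wrap guard sits PER MEMBER, INSIDE the rows ((R1ᴰ-Loc) at
`n`; (R4ᴰ) at `n` and `n+1`; (R3)(R5) window-free) — never as a blanket antecedent (member `n = 0` wraps at the record's base volume, which would empty the consequent).
REMARK (CRIT-1, for the porter): at the flat background the abrupt cubic window problem is the free problem with IMAGE sources — rows 1–3 follow from the free∕torus (190) bounds at every
stencil not containing an exterior–exterior bond; the guard need only exclude the wall layer (`R3 + 1 ≤ R0`).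

HONEST FRAMING.  Definitions only; NOTHING of Bałaban is asserted, ported or discharged; 27931 OPEN (row 4 MISSTATED-OBJECT, RC-3 in progress: ⁷⁗ «v10-Loc» to be cut over THESE names
and signed by CRIT-1); 27930⁸∕26648 SIGNED·OPEN; K0⁷∕K-Ax OPEN; NODE O 0∕1; COUNT 8∕28 · K 1∕4 UNMOVED; finite `𝕋⁴_{L^K}` at fixed ε — NOT continuum ∕ ℝ⁴ ∕ OS; **the Yang–Mills mass
gap (Clay) is NOT proved by any of this.**  No `sorry`, `instance`, `notation`; standard axioms.
-/

noncomputable section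

open scoped BigOperators Matrix.Norms.L2Operator

namespace Summit.QuantumFields.YangMills.Theorems.K0RecordFormatNames

open Literature.MathematicalPhysics.QuantumFieldTheory.Balaban1983to89
open Literature.MathematicalPhysics.QuantumFieldTheory.Balaban1983to89.Node00
open Literature.MathematicalPhysics.QuantumFieldTheory.Balaban1983to89.T4Continuum (T4Family)
open Literature.MathematicalPhysics.QuantumFieldTheory.Balaban1983to89.B12FormatPlus (cutTo restrictCLM)
open NormedSpace (exp)

variable (F : T4Family)

/-! ## §24g  N-1: the chart-unit (`ξ`-scaled) localized response and its chain -/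

/-- **`windowRespξ W l := ξ · windowResp W l`**, `ξ = eta (k+1) = L^{−(k+1)}` — the scalar window response IN CHART UNITS (`log U = iξA`): the linear-order localized field whose coarse
holonomy reproduces the datum. [cite: Balaban1987RG1, (1.1) p.260, (3.37) p.277, (4.2) p.281; Balaban1984PropagatorsII, (2.35) p.228] -/
def windowRespξ (k K : ℕ) (W : Finset (Site (F.P K) (k + 1))) (l : RespLabel F k K) (b : PBond (F.P K) 0) : ℝ :=
  (F.P K).eta (k + 1) * windowResp F k K W l b

section Theta

variable (θ : Stage13Params F 2)

/-- ★ **`recordHrLocξ F θ k K W a l b i i' := ξ·windowResp W l b · ρ₈(bV a)_{ii'}`** — THE □₀-LOCALIZED RESPONSE AT LINEAR ORDER IN CHART UNITS (the object the (T5′) token's ξ-scaled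
clauses read; instance: □₀-localized DOMAIN problem [B6] (2.5)–(2.6), Ω₀ = T, A pinned on Λ₀ = Wᶜ; flat background U₀ = 1 (K7-c); linear order). [cite: Balaban1987RG1, (3.37) p.277, (4.35) p.290, (1.1) p.260; Balaban1984PropagatorsII, (2.35) p.228] -/
def recordHrLocξ (k K : ℕ) (W : Finset (Site (F.P K) (k + 1))) (a : θ.ιβ) (l : RespLabel F k K) : PBond (F.P K) 0 → Fin 2 → Fin 2 → ℂ :=
  letI := θ.instVβ₁; letI := θ.instVβ₂
  fun b i i' => (windowRespξ F k K W l b : ℂ) * θ.ρ8 (θ.bV a) i i'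

/-- **The linear localized representation in chart units**: `A′_B(b) := Σ_l ξ·windowResp W l b · ρ₈(B l)`. [cite: Balaban1987RG1, (4.2) p.281, (3.37) p.277] -/
def recordALocξ (k K : ℕ) (W : Finset (Site (F.P K) (k + 1))) (B : Fin (F.P K).d → Site (F.P K) (k + 1) → θ.Vβ) : PBond (F.P K) 0 → MatA 2 :=
  letI := θ.instVβ₁; letI := θ.instVβ₂
  fun b => ∑ l : RespLabel F k K, (windowRespξ F k K W l b : ℂ) • θ.ρ8 (B l.1 l.2)

/-- **The localized configuration `exp(A′_B)` (chart units)** read in `SU(2)` through `suOfMat` — its coarse holonomy reproduces `exp(ρ₈B)` at linear order (N-1's consistency test).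
[cite: Balaban1987RG1, (3.37) p.277, (4.2) p.281] -/
def recordCfgLocξ (k K : ℕ) (W : Finset (Site (F.P K) (k + 1))) (B : Fin (F.P K).d → Site (F.P K) (k + 1) → θ.Vβ) : GaugeField (F.P K) 0 (SU 2) :=
  fun b => suOfMat 2 (exp (recordALocξ F θ k K W B b))

/-- **The (1.9) pair of the chart-unit localized configuration** `(exp A′_B, J_{k+1}(exp A′_B))`. [cite: Balaban1987RG1, (1.8)–(1.9) p.261, (3.24) p.275] -/
def recordPairLocξ (k K : ℕ) (W : Finset (Site (F.P K) (k + 1))) (B : Fin (F.P K).d → Site (F.P K) (k + 1) → θ.Vβ) : Sect2.CPair (F.P K) (MatA 2) :=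
  (fun b => ((recordCfgLocξ F θ k K W B b : SU 2) : MatA 2),
    B12Eq18Current.current sl2Proj ((F.P K).eta (k + 1)) fun b => ιSU 2 (recordCfgLocξ F θ k K W B b))

/-- **`recordJLocξ`** — the linearised current of the chart-unit localized configuration in the direction `δ_l ⊗ bV a`: `d∕dt|₀ J_{k+1}(exp(t·HrLocξ))(b)` entrywise.
[cite: Balaban1987RG1, (1.8) p.261, (3.24) p.275, (4.35) p.290] -/
def recordJLocξ (k K : ℕ) (W : Finset (Site (F.P K) (k + 1))) (a : θ.ιβ) (l : RespLabel F k K) (b : PBond (F.P K) 0) : MatA 2 :=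
  letI := θ.instVβ₁; letI := θ.instVβ₂; letI := θ.instιβ
  Matrix.of fun i i' => deriv (fun t : ℝ => (recordPairLocξ F θ k K W (Pi.single l.1 (Pi.single l.2 (t • θ.bV a)))).2 b i i') 0

/-- **`recordGkLocWξ F θ k K W a l i`** — the two-block localized response coordinates IN CHART UNITS at the window `W` (𝐔-block from `recordHrLocξ`, 𝐉-block from `recordJLocξ`).
[cite: Balaban1987RG1, (4.35) p.290, (1.9) p.261; Balaban1985Variational, Prop. 9 p.309] -/
def recordGkLocWξ (k K : ℕ) (W : Finset (Site (F.P K) (k + 1))) (a : θ.ιβ) (l : RespLabel F k K) (i : Fin (recordChartDimJ F K)) : ℂ :=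
  Sum.elim
    (fun c => sl2Coord (Matrix.of fun i₁ i₂ => recordHrLocξ F θ k K W a l ((chartEquivJ F K).symm i).1 i₁ i₂) c)
    (fun c => sl2Coord (recordJLocξ F θ k K W a l ((chartEquivJ F K).symm i).1) c)
    ((chartEquivJ F K).symm i).2

/-- **`ι_Locξ` — the chart-unit localized chart at a fixed window** (JOIN-side, per term): two-block coordinates of `recordPairLocξ W B`. [cite: Balaban1987RG1, (3.24) p.275, (4.2) p.281, (4.35) p.290, (1.9) p.261] -/
def recordEmbLocξ (k K : ℕ) (W : Finset (Site (F.P K) (k + 1))) (B : Fin (F.P K).d → Site (F.P K) (k + 1) → θ.Vβ) : Fin (recordChartDimJ F K) → ℂ :=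
  fun i => Sum.elim
    (fun c => sl2Coord (MatrixLog.mlog ((recordPairLocξ F θ k K W B).1 ((chartEquivJ F K).symm i).1)) c)
    (fun c => sl2Coord ((recordPairLocξ F θ k K W B).2 ((chartEquivJ F K).symm i).1) c)
    ((chartEquivJ F K).symm i).2

/-- **RECEIPT (E1′)-Locξ**: the chart-unit localized chart is `C²` at `0` and vanishes there. [cite: Balaban1987RG1, (4.35) p.290; Balaban1985Variational, Prop. 9 p.309] -/
def IotaRowAtLocξ (k K : ℕ) (W : Finset (Site (F.P K) (k + 1))) : Prop :=
  letI := θ.instVβ₁; letI := θ.instVβ₂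
  ContDiffAt ℝ 2 (recordEmbLocξ F θ k K W) 0 ∧ recordEmbLocξ F θ k K W 0 = 0

/-- **RECEIPT (E4a)-Locξ**: the first derivative of the chart-unit localized chart at `0` on the basis fields IS `recordGkLocWξ W`.  Displayed, not asserted.
[cite: Balaban1987RG1, (4.35) p.290; Balaban1985Variational, Prop. 9 p.309] -/
def ResponseRowAtLocξ (k K : ℕ) (W : Finset (Site (F.P K) (k + 1))) (a : θ.ιβ) : Prop :=
  letI := θ.instVβ₁; letI := θ.instVβ₂; letI := θ.instιβ
  ∀ (l : RespLabel F k K) (i : Fin (recordChartDimJ F K)),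
    fderiv ℝ (recordEmbLocξ F θ k K W) 0 (Pi.single l.1 (Pi.single l.2 (θ.bV a))) i = recordGkLocWξ F θ k K W a l i

end Theta

/-! ## §24h  N-2: the term's window at a volume-independent index, the per-member no-wrap guard, the data and the guarded receipts -/

/-- **`recordWindow F k K R0 z₀`** — THE TERM's WINDOW: the cube of radius `R0` (coarse sites) about the centre labelled `z₀ : Fin 4 → ℤ` (volume-independent index; the same `z₀`, `R0`
name the same window problem in every member). [cite: Balaban1987RG1, p.270, p.273 (□₀), (1.21) p.264] -/
def recordWindow (k K R0 : ℕ) (z₀ : Fin 4 → ℤ) : Finset (Site (F.P K) (k + 1)) :=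
  windowSites F k K R0 (recordCubeCtr F k K z₀)

/-- **SIDE CONDITION `NoWrapAt F k K R0 z₀`** (per member): the cube of radius `R0 + 1` about `z₀` lies inside the CENTRED fundamental window of `T^{(k+1)}_K` —
`2·(|z₀ μ| + R0 + 1) < N_{k+1}(K)` in every direction. [cite: Balaban1987RG1, (1.21) p.264, p.275 L5–8] -/
def NoWrapAt (k K R0 : ℕ) (z₀ : Fin 4 → ℤ) : Prop :=
  ∀ μ : Fin 4, 2 * (|z₀ μ| + (R0 : ℤ) + 1) < ((F.P K).sitesPerDir (k + 1) : ℤ)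

section Theta

variable (θ : Stage13Params F 2)

/-- **`recordGkLocAtξ F θ k K R0 z₀ a l i := recordGkLocWξ … (recordWindow … R0 z₀) a l i`** — the chart-unit localized response coordinates at the term's window.
[cite: Balaban1987RG1, (4.35) p.290, (3.37) p.277; Balaban1985Variational, Prop. 9 p.309] -/
def recordGkLocAtξ (k K R0 : ℕ) (z₀ : Fin 4 → ℤ) (a : θ.ιβ) (l : RespLabel F k K) (i : Fin (recordChartDimJ F K)) : ℂ :=
  recordGkLocWξ F θ k K (recordWindow F k K R0 z₀) a l i

/-- **The chart-unit localized response data at `(R0, z₀)` from the base volume `K₀`** (member `n` = volume `K₀ + n`; the same `z₀`, `R0` in every member).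
[cite: Balaban1985Variational, Prop. 9 p.309; Balaban1987RG1, (1.21) p.264, (4.35) p.290] -/
def recordResponse9DataFromLocAtξ (a : θ.ιβ) (Mc k K₀ R0 : ℕ) (z₀ : Fin 4 → ℤ) :
    B12FormatPlus.Response9Data (fun n => recordDomSys F Mc k (K₀ + n)) (fun n => recordBondCount F (K₀ + n)) (fun n => recordChartDimJ F (K₀ + n)) 4 where
  Cc := fun n => recordCc F Mc k (K₀ + n)
  Λ := fun n => RespLabel F k (K₀ + n)
  G := fun n => recordSiteGeom F Mc k (K₀ + n)
  ρ := fun n => recordRho F k (K₀ + n)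
  e := fun n => recordE F k (K₀ + n)
  cX := fun n => recordCXJ F Mc k (K₀ + n)
  siteOf := fun n => recordSiteOfJ F k (K₀ + n)
  Gk := fun n => recordGkLocAtξ F θ k (K₀ + n) R0 z₀ a
  wrap := fun n => recordWrapCtr F Mc k (K₀ + n)
  emb := fun n => recordDomEmbCtr F Mc k (K₀ + n)
  jX := fun n _ => recordJXJ F (K₀ + n)
  πc := fun n _ => recordCoordProjCtr F (K₀ + n)

end Theta

/-- **`Response9DLocW` — `Response9D` WITH THE (R1ᴰ-Loc) INNER GUARD AND THE PER-MEMBER NO-WRAP GUARDS INSIDE** (CRIT-1 (T6′) 02:17:09Z + word (b) 02:36:04Z): (R0) constants;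
**(R1ᴰ-Loc)** `∀ n X y, nowrap n → (∀ i ∈ cX n X, inner n (siteOf n i)) → gauge (D n X) (cutTo (cX n X) (Gk n y)) ≤ C₉·e^{−δ₀·dist(y, X)}`; (R3) unwrap compatibility VERBATIM;
**(R4ᴰ-Loc)** the two-volume comparison VERBATIM under `nowrap n → nowrap (n+1) →`; (R5) chart intertwining VERBATIM.  Generic; hypothesis form; asserts nothing.
[cite: Balaban1985Variational, Prop. 9 p.309, (190) p.308; Balaban1987RG1, (4.4)–(4.5) pp.281–282, p.274 L9–13, (1.21) p.264, (4.35) p.290] -/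
def Response9DLocW {S : ℕ → LocDomainSys} {M m : ℕ → ℕ} {d : ℕ} (R : B12FormatPlus.Response9Data S M m d)
    (χ : (n : ℕ) → (S n).Dom → (Fin (m n) → ℂ) → (Fin (M n) → ℂ)) (N : ℕ → ℕ) (D : (n : ℕ) → (S n).Dom → Set (Fin (m n) → ℂ))
    (inner : (n : ℕ) → R.Λ n → Prop) (nowrap : ℕ → Prop) (C₉ δ₀ : ℝ) : Prop :=
  0 ≤ C₉ ∧ 0 ≤ δ₀ ∧
  (∀ n X y, nowrap n → (∀ i ∈ R.cX n X, inner n (R.siteOf n i)) →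
    gauge (D n X) (cutTo (R.cX n X) (R.Gk n y)) ≤ C₉ * Real.exp (-δ₀ * (R.G n).distD y X)) ∧
  (∀ n X, X ∉ R.wrap n → ∀ i ∈ R.cX n X, R.jX n X i ∈ R.cX (n + 1) (R.emb n X)) ∧
  (∀ n X, X ∉ R.wrap n → nowrap n → nowrap (n + 1) → ∀ (μ : Fin d) (z : Fin d → ℤ), (∀ l, 2 * |z l| < (N n : ℤ)) →
    gauge (D n X) (cutTo (R.cX n X) fun i => R.Gk (n + 1) (R.e (n + 1) μ z) (R.jX n X i) - R.Gk n (R.e n μ z) i) ≤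
      C₉ * Real.exp (-δ₀ * (N n : ℝ) / 2) * Real.exp (-(δ₀ / 2) * (R.G n).distD (R.e n μ z) X)) ∧
  (∀ n X, X ∉ R.wrap n → ∀ w', R.πc n X (χ (n + 1) (R.emb n X) w') = χ n X (restrictCLM (R.cX n X) (R.jX n X) w'))

section Theta

variable (θ : Stage13Params F 2)

/-- ★ **RECEIPT `Response9DLocAt F θ a Mc k K₀ R0 R3 z₀ α₂ C₉ δ₀`** (CRIT-1's name, word (c)): 27931 ⁷⁗'s response half = `Response9DLocW` for the chart-unit localized data at
`(R0, z₀)` in the gauge norm of the two-block (4.4) domain, CENTRED layer, radius `recordRNat`, base volume `K₀`, inner guard «the label over each chart input of `X` lies in the cube of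
radius `R3` about `z₀`» and per-member guard `NoWrapAt … (K₀+n) R0 z₀` (instance: □₀-localized DOMAIN problem [B6] (2.5)–(2.6), Ω₀ = T, A pinned on Λ₀ = □₀ᶜ; flat background
U₀ = 1 (K7-c); linear order; chart units).  Prop-valued; asserts nothing; the cutter binds `R0 R3` early with `R3 + 1 ≤ R0` and quantifies `∀ z₀`.
[cite: Balaban1985Variational, Prop. 9 p.309; Balaban1987RG1, (4.4) p.281, (4.35) p.290, (3.37) p.277, (1.21) p.264] -/
def Response9DLocAt (a : θ.ιβ) (Mc k K₀ R0 R3 : ℕ) (z₀ : Fin 4 → ℤ) (α₂ C₉ δ₀ : ℝ) : Prop :=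
  Response9DLocW (recordResponse9DataFromLocAtξ F θ a Mc k K₀ R0 z₀) (fun n => recordChartJ F Mc k (K₀ + n)) (fun n => recordRNat F Mc k (K₀ + n))
    (fun n X => recordDom44J F Mc k (K₀ + n) X α₂) (fun n l => l.2 ∈ recordWindow F k (K₀ + n) R3 z₀) (fun n => NoWrapAt F k (K₀ + n) R0 z₀) C₉ δ₀

end Theta

end Summit.QuantumFields.YangMills.Theorems.K0RecordFormatNames

end
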